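import Literature.NumberTheory.Transcendental.RoySmallValueLevels
import Literature.NumberTheory.Transcendental.RoySmallValueCycleHeights
import Literature.NumberTheory.Transcendental.RoySmallValuePhiLength
import HarnessLib

/-!
# Roy's small value estimate for `𝔾ₐ × 𝔾ₘ` — the height of `𝒵(P̃, Q)` for a level package

Topic `Literature/NumberTheory/Transcendental`. Part of the formalisation of the proof of Roy 2013,
Theorem 1.1 (named fact `roy2013_thm_1_1`, `RoySmallValueEstimates.lean`), seat B. Source: D. Roy,
*A small value estimate for `𝔾ₐ × 𝔾ₘ`*, Mathematika 59 (2013) 333–363 = arXiv:1301.0663, §2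
(Prop. 2.2 (ii)), §6 (proof of Prop. 6.4) and §7, Step 3 (pp. 6, 17, 19):

> [...] `F(R) = a R(α₁)^{e₁} ⋯ R(α_t)^{e_t}` [...] for some `a ∈ ℂ^×` [...] this polynomial has
> integer coefficients and [...] `‖F‖ ≤ N! ‖P‖^N ‖Q‖^N` [...]
> `h(Z) ≤ h(𝒵(P,Q)) ≤ [...] ≤ D(log‖P‖ + log‖Q‖) + 16 log(3) D²` [...]
> (Step 3) `h(Z) ≤ 6(D*+1)^{1+β} / ⌊(D*+1)^τ⌋`.

For a level package `L : LevelPkg D P̃` of the parallel seat's `RoySmallValueLevels` (the coprime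
companion `Q`, the data of `Φ`, normalised representatives `αᵢ` of `𝒵(P̃, Q)(ℂ)`, the complex
factorisation `Φ(P̃, Q, ·) = c ∏ ℓ_{αᵢ}^{eᵢ}`) and a normal number field `K ⊂ ℂ` containing the
coordinates (`L.cfg K hK : ZeroConfigK`), this file supplies the ARITHMETIC consequences:

* `intF`, `map_intF` — `F₀ = Φ(P̃, Q, ·) ∈ ℤ[r]` and its complexification (`map_royF`);
  `intF_ne_zero`;
* (the descent of the factorisation to `K` and the constancy of `eᵢ` on Galois orbits are the
  parallel seat's `RoySmallValueDescentK.exists_factorisation_fld` / `mult_perm`, built on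
  `RoySmallValueFactorizationK`;)
* **`sum_e_mul_height_le`** — `∑ᵢ eᵢ · D · h_K(rep i) ≤ [K:ℚ] · log 𝓛(F₀)`
  (`RoySmallValueCycleHeights`), and `log 𝓛(F₀) ≤ log N! + N₀ log⁺‖P̃‖ + N₁ log⁺‖Q‖`-type
  control through `l1Norm_royF_le` (`log_length_intF_le`).

Everything is proved; the only new definition is the name `intF` for `royF … P̃ Q` over `ℤ` (with body); no named facts.

## References

* [Roy2013] D. Roy, *A small value estimate for 𝔾ₐ × 𝔾ₘ*, Mathematika 59 (2013), 333–363
  (arXiv:1301.0663), Prop. 2.2 (ii); §6, proof of Prop. 6.4; §7, Step 3.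
-/

noncomputable section

open MvPolynomial Finset Height

namespace Literature.NumberTheory.Transcendental

namespace Roy2013

open Nesterenko

namespace LevelPkg

variable {D : ℕ} {Pt : MvPolynomial (Fin 3) ℤ} (L : LevelPkg D Pt)

/-! ### `F₀ = Φ(P̃, Q, ·)` with integer coefficients -/

/-- `F₀ = Φ(P̃, Q, ·) ∈ ℤ[r]`. [cite: Roy2013, §2 ("`F` has integer coefficients"), §6 proof of Prop. 6.4] -/
def intF : MvPolynomial (CoefIdx D) ℤ := royF D L.M₁ L.M₂ L.σ Pt (levelQ D Pt L.t)

/-- Unfolding. [folklore] -/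
theorem intF_def : L.intF = royF D L.M₁ L.M₂ L.σ Pt (levelQ D Pt L.t) := rfl

/-- Its complexification is `Φ(P̃ ⊗ ℂ, Q ⊗ ℂ, ·)`. [folklore] -/
theorem map_intF : map (Int.castRingHom ℂ) L.intF =
    royF D L.M₁ L.M₂ L.σ (map (Int.castRingHom ℂ) Pt) (map (Int.castRingHom ℂ) (levelQ D Pt L.t)) := by
  rw [intF_def, map_royF]

/-- `F₀ ≠ 0`. [cite: Roy2013, §6, proof of Prop. 6.4] -/
theorem intF_ne_zero : L.intF ≠ 0 := by
  intro h0
  have h := L.hFeq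
  rw [← map_intF, h0, map_zero] at h
  have hne : C L.c * ∏ i, evalForm D (L.α i) ^ L.e i ≠ 0 :=
    mul_ne_zero (by rw [Ne, C_eq_zero]; exact L.hc)
      (prod_ne_zero_iff.mpr fun i _ => pow_ne_zero _ (evalForm_ne_zero (L.α_ne_zero i)))
  exact hne h.symm

/-! ### Over the number field `K` -/

variable (K : IntermediateField ℚ ℂ) (hK : ∀ i k, L.α i k ∈ K)

/-- The embedding composed with the `K`-representatives gives back the complex points. [folklore] -/
theorem val_comp_rep (i : Fin L.m) :
    ((algebraMap K ℂ : K →+* ℂ) ∘ (L.cfg K hK).rep i : Fin 3 → ℂ) = L.α i :=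
  funext fun _ => rfl

/-- The complex factorisation rewritten with the `K`-representatives. [folklore] -/
theorem map_intF_eq_prod :
    map (Int.castRingHom ℂ) L.intF =
      C L.c * ∏ i, evalForm D ((algebraMap K ℂ : K →+* ℂ) ∘ (L.cfg K hK).rep i) ^ L.e i := by
  rw [map_intF]
  simp only [val_comp_rep]
  exact L.hFeq

/-! ### The height of `𝒵(P̃, Q)` -/

variable [NumberField K]

/-- **`∑ᵢ eᵢ · D · h_K(rep i) ≤ [K:ℚ] · log 𝓛(F₀)`** for the level package.
[cite: Roy2013, Prop. 2.2 (ii); §6, proof of Prop. 6.4; §7, Step 3] -/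
theorem sum_e_mul_height_le :
    ∑ i, (L.e i : ℝ) * (D * logHeight ((L.cfg K hK).rep i)) ≤
      Module.finrank ℚ K * Real.log (∑ m ∈ L.intF.support, |((coeff m L.intF : ℤ) : ℝ)|) :=
  sum_mul_height_le_log_length_of_complex (algebraMap K ℂ : K →+* ℂ)
    (fun i => (L.cfg K hK).rep_ne_zero i) L.intF_ne_zero (L.map_intF_eq_prod K hK)

omit [NumberField K] in
/-- `𝓛(F₀) = 𝓛(Φ(P̃ ⊗ ℂ, Q ⊗ ℂ, ·)) ≤ N! ‖P̃‖^{N₀} ‖Q‖^{N₁}`. [cite: Roy2013, §6, proof of Prop. 6.4 (`‖F‖ ≤ N!‖P‖^N‖Q‖^N`)] -/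
theorem length_intF_le :
    ∑ m ∈ L.intF.support, |((coeff m L.intF : ℤ) : ℝ)| ≤
      (Fintype.card (PhiRow D)).factorial *
        (maxNorm (map (Int.castRingHom ℂ) Pt) ^
            Fintype.card ↥(finsuppAntidiag (univ : Finset (Fin 3)) (2 * D)) *
          maxNorm (map (Int.castRingHom ℂ) (levelQ D Pt L.t)) ^ Fintype.card ↥L.M₁) := by
  rw [← l1Norm_map_intCast, map_intF]
  exact l1Norm_royF_le L.σ _ _

omit [NumberField K] in
/-- `𝓛(F₀) ≥ 1` (a non-zero integer polynomial). [folklore] -/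
theorem one_le_length_intF : 1 ≤ ∑ m ∈ L.intF.support, |((coeff m L.intF : ℤ) : ℝ)| := by
  obtain ⟨m, hm⟩ := MvPolynomial.ne_zero_iff.mp L.intF_ne_zero
  have hm' : m ∈ L.intF.support := mem_support_iff.mpr hm
  have h1 : (1 : ℝ) ≤ |((coeff m L.intF : ℤ) : ℝ)| := by
    have h : ((1 : ℤ) : ℝ) ≤ ((|coeff m L.intF| : ℤ) : ℝ) := Int.cast_le.mpr (Int.one_le_abs hm)
    rw [Int.cast_one, Int.cast_abs] at h
    exact h
  exact h1.trans (single_le_sum (f := fun m => |((coeff m L.intF : ℤ) : ℝ)|)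
    (fun _ _ => abs_nonneg _) hm')

/-- **The height bound in closed form**: `∑ᵢ eᵢ D h_K(rep i) ≤ [K:ℚ] (log N! + N₀ log M_P + N₁ log M_Q)`
whenever `‖P̃‖ ≤ M_P`, `‖Q‖ ≤ M_Q` with `M_P, M_Q ≥ 1`. [cite: Roy2013, §6, proof of Prop. 6.4; §7, Step 3] -/
theorem sum_e_mul_height_le' {MP MQ : ℝ} (hMP : 1 ≤ MP) (hMQ : 1 ≤ MQ)
    (hP : maxNorm (map (Int.castRingHom ℂ) Pt) ≤ MP)
    (hQ : maxNorm (map (Int.castRingHom ℂ) (levelQ D Pt L.t)) ≤ MQ) :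
    ∑ i, (L.e i : ℝ) * (D * logHeight ((L.cfg K hK).rep i)) ≤
      Module.finrank ℚ K * (Real.log (Fintype.card (PhiRow D)).factorial +
        Fintype.card ↥(finsuppAntidiag (univ : Finset (Fin 3)) (2 * D)) * Real.log MP +
        Fintype.card ↥L.M₁ * Real.log MQ) := by
  have h1 := L.sum_e_mul_height_le K hK
  have hlen := L.length_intF_le
  have hlen1 := L.one_le_length_intF
  have hn : (0 : ℝ) ≤ Module.finrank ℚ K := Nat.cast_nonneg _
  refine h1.trans (mul_le_mul_of_nonneg_left ?_ hn)
  -- abbreviate the cardinalities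
  obtain ⟨N, hN⟩ : ∃ N : ℕ, N = Fintype.card (PhiRow D) := ⟨_, rfl⟩
  obtain ⟨N₀, hN₀⟩ : ∃ N₀ : ℕ, N₀ = Fintype.card ↥(finsuppAntidiag (univ : Finset (Fin 3)) (2 * D)) :=
    ⟨_, rfl⟩
  obtain ⟨N₁, hN₁⟩ : ∃ N₁ : ℕ, N₁ = Fintype.card ↥L.M₁ := ⟨_, rfl⟩
  rw [← hN, ← hN₀, ← hN₁] at hlen ⊢
  have hfact : (0 : ℝ) < (N.factorial : ℝ) := Nat.cast_pos.mpr (Nat.factorial_pos N)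
  have hMP0 : 0 < MP := lt_of_lt_of_le one_pos hMP
  have hMQ0 : 0 < MQ := lt_of_lt_of_le one_pos hMQ
  have hP0 : 0 ≤ maxNorm (map (Int.castRingHom ℂ) Pt) := maxNorm_nonneg _
  have hQ0 : 0 ≤ maxNorm (map (Int.castRingHom ℂ) (levelQ D Pt L.t)) := maxNorm_nonneg _
  have hpowP : maxNorm (map (Int.castRingHom ℂ) Pt) ^ N₀ ≤ MP ^ N₀ := pow_le_pow_left₀ hP0 hP N₀
  have hpowQ : maxNorm (map (Int.castRingHom ℂ) (levelQ D Pt L.t)) ^ N₁ ≤ MQ ^ N₁ :=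
    pow_le_pow_left₀ hQ0 hQ N₁
  have hlen2 : ∑ m ∈ L.intF.support, |((coeff m L.intF : ℤ) : ℝ)| ≤
      (N.factorial : ℝ) * (MP ^ N₀ * MQ ^ N₁) := by
    refine hlen.trans (mul_le_mul_of_nonneg_left ?_ hfact.le)
    exact mul_le_mul hpowP hpowQ (pow_nonneg hQ0 _) (pow_nonneg hMP0.le _)
  have hpos1 : (0 : ℝ) < MP ^ N₀ := pow_pos hMP0 _
  have hpos2 : (0 : ℝ) < MQ ^ N₁ := pow_pos hMQ0 _
  calc Real.log (∑ m ∈ L.intF.support, |((coeff m L.intF : ℤ) : ℝ)|)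
      ≤ Real.log ((N.factorial : ℝ) * (MP ^ N₀ * MQ ^ N₁)) :=
        Real.log_le_log (lt_of_lt_of_le one_pos hlen1) hlen2
    _ = Real.log (N.factorial : ℝ) + N₀ * Real.log MP + N₁ * Real.log MQ := by
        rw [Real.log_mul hfact.ne' (mul_pos hpos1 hpos2).ne', Real.log_mul hpos1.ne' hpos2.ne',
          Real.log_pow, Real.log_pow, add_assoc]

end LevelPkg

end Roy2013

end Literature.NumberTheory.Transcendental
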